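/-
Copyright (c) 2026 the pub-hodgecm-mathlib formalisation cell (harness21).  Prover seat hodgecm-mathlib-F0P3a-p01 (g39), explicit-unit SUPPORTS-ONLY on h413, req620 Track A
«(D-RAM) FOUR-FRAME» squad ((β₂) road (R-36) «RAY BANDS» ∕ K6, lane A (Unr-K) port: the socket's FIBRE letter (hF) on type U — LH4-p16's ★ `…RowCellSocketFibre` with
the RamK class letters replaced by the type-U flip ★ p864540; road (I), Θ-fixed chart), 2026-09-05.
-/
import Summits.HodgeConjecture.HodgeConjecture.Theorems.F0P3cDyRamRowCellSocketFibre        -- ★ (LH4-p16): lane-B (hF) + §1 `socketFibre_eq_sphereFibre`; brings ★ p863524 transport, ★ `transportMul_letters`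
import Summits.HodgeConjecture.HodgeConjecture.Theorems.F0P3cDyRamUnrKFrameClassLetters    -- ★ p864540 (this lineage, g38): `forall_theta_fixed_unit_isNorm_of_typeU` (the type-U flip)
import HarnessLib

/-!
# Crux `H413`, line LH4 «(D-RAM) FOUR-FRAME» — (β₂) road, lane A (type U ∕ Unr-K): «THE SOCKET FIBRES ARE EQUINUMEROUS ON TYPE U — NO CLASS LETTERS» —
# `fibre_ncard_eq_of_lit_of_gen_typeU` = ★ `…RowCellSocketFibre.fibre_ncard_eq_of_lit_of_gen` with `(c₀ hc₀1 hdich hwit)` ↦ `(hvΘ hα1 hU hτ)`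

Cell `hodgecm-mathlib` (D-0151), FLOOR 0, crux item H413 = `stmt-HodgeConjecture-24833`, route of record `HCCMUnconditional`; squad F0∕P3c∕LH4; lane
`--supports stmt-HodgeConjecture-24833 --as helper` (count-neutral; pays NO tier-0 row).  THEOREMS ONLY (no `def`, no instance, no notation, no `sorry`, default heartbeats);
★-only imports; states NO law; (β₂) stays a HYPOTHESIS.

WHY (LH4-p19 (g3) RAYBANDS ENGINE MAP v1 6dfdb380: the lane-specific inputs of the RAY worker ★ W3 are F4's class letters, consumed ONLY by ★ `fibre_ncard_eq_of_lit_of_gen` at W3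
l.344; this seat's ★ p864540: on type U the RamK class letters `hdich`∕`hwit` are FALSE, but EVERY Θ-fixed unit is a Θ-norm).  ★ `…RowCellSocketFibre` (LH4-p16) transports the
socket fibre over a literal digit `y` to the one over `y′` by a flip `εΘε = ρκ₂∕ρκ₁` (★ p863604 `exists_flip_of_sameClass`, which needs `c₀`, the unit dichotomy `hdich` and the
witness `hwit` to match `Q`-classes) and ★ p863524 `ncard_fibre_eq_ncard_fibre_of_sphere`.  On TYPE U the quotient `ρκ₂∕ρκ₁` of two Θ-fixed sphere points of equal size is a Θ-fixed
UNIT (★ `transportMul_letters`), hence a Θ-norm `εΘε` by ★ p864540 with NO class condition — so the (hF) letter holds in lane A with the class letters DROPPED (replaced by the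
type-U frame letters `hvΘ hα1 hU hτ`), everything else ★'s BYTE FOR BYTE (the reference pair stays Θ-fixed: road (I), ★ `…UnrKThetaFixedRefPair`; `|κ₀|` is free here).
* §1 `ncard_socketFibre_eq_of_lit_typeU` — two-digit form; §2 HEAD `fibre_ncard_eq_of_lit_of_gen_typeU` — (hF) in ★ p864098's socket shape.
HONEST LABEL.  Count-neutral lattice bookkeeping; nothing printed is asserted; no census law is stated; ‹LINE-U-A-RAY›∕‹LINE-L-A-RAY›∕‹CORE-A› and (β₂) stay HYPOTHESES (β₂
UNPROVED); `HC_CM` is proved only modulo the 7 printed citations (2 remaining named inputs: hLiu418 = `stmt-HodgeConjecture-24832`, h413 = `stmt-HodgeConjecture-24833`) until rung 0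
closes.
## References
* [Kottwitz1986BaseChangeUnits] R. E. Kottwitz, *Base change for unit elements of Hecke algebras*, Compositio Math. 60 (1986): §1 pp. 240–241 (fixed-lattice counts as orbital integrals).
* [Flicker1998UnitaryFL] Y. Z. Flicker, *Elementary proof of the fundamental lemma for a unitary group*, Canad. J. Math. 50 (1998): Prop. 7 p. 84 (torus-orbit census).
* [Serre1979] J.-P. Serre, *Local Fields*, GTM 67 (1979): Ch. V §2 Prop. 3 (units of an unramified extension are norms); Ch. XIV §6.
* [Jacobowitz1962] R. Jacobowitz, *Hermitian forms over local fields*, Amer. J. Math. 84 (1962): §4 (dual lattices, gluing).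
-/

set_option autoImplicit false

noncomputable section

namespace Summit.HodgeConjecture.HodgeConjecture.Cruxes.H413.F0P3cDyRamRowCellSocketFibreTypeU

open scoped Valued WithZero
open WithZero Finset
open Literature.NumberTheory.Automorphic.UnitaryThreeFourFrame (IsRamifiedQuadraticDatum)
open Summit.HodgeConjecture.HodgeConjecture.Cruxes.H413.F0P3cDyRamToricCensusDefs
open Summit.HodgeConjecture.HodgeConjecture.Cruxes.H413.F0P3cDyRamRowCellSphereTransport (ncard_fibre_eq_ncard_fibre_of_sphere)
open Summit.HodgeConjecture.HodgeConjecture.Cruxes.H413.F0P3cDyRamRowCellDigitRealisability (transportMul_letters)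
open Summit.HodgeConjecture.HodgeConjecture.Cruxes.H413.F0P3cDyRamRowCellSocketFibre (socketFibre_eq_sphereFibre)
open Summit.HodgeConjecture.HodgeConjecture.Cruxes.H413.F0P3cDyRamUnrKFrameClassLetters (forall_theta_fixed_unit_isNorm_of_typeU)

variable {E M : Type} [Field E] [Valued E ℤᵐ⁰] [Field M] [Valued M ℤᵐ⁰] {ρ Θ : M →+* M} {α : M}

/-! ## §1 Two literal digits, type U -/

/-- **LANE A (type U ∕ Unr-K): «THE SOCKET FIBRES OVER TWO LITERAL DIGITS ARE EQUINUMEROUS» WITHOUT CLASS LETTERS.**  ★ `…RowCellSocketFibre.ncard_socketFibre_eq_of_lit`'s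
statement with the RamK class letters `(c₀) (hc₀1) (hdich) (hwit)` REPLACED by the type-U letters `(hvΘ) (hα1) (hU : |α − ρα| = 1) (hτ : |ρα − Θα| < 1)`: the flip
`εΘε = ρκ₂∕ρκ₁` between two Θ-fixed sphere points of equal size exists UNCONDITIONALLY on type U (★ p864540 `forall_theta_fixed_unit_isNorm_of_typeU` — `M ∕ Fix Θ` unramified,
every Θ-fixed unit is a Θ-norm), then ★ p863524 `ncard_fibre_eq_ncard_fibre_of_sphere` at `μ = 0` as in lane B.  (The class clauses of `hy`, `hy'` are carried for socket-shape
parity with ★ p864098's (hF) and are NOT used.) [cite: Kottwitz1986BaseChangeUnits, §1 pp. 240–241] [cite: Serre1979, Ch. V §2 Prop. 3; Ch. XIV §6] [cite: Jacobowitz1962, §4] -/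
theorem ncard_socketFibre_eq_of_lit_typeU [CompleteSpace M] [Finite 𝓀[M]] {σ : E →+* E} {ϖ : E} {d tE : ℕ} (hD : IsRamifiedQuadraticDatum σ ϖ d tE)
    (jE : E →+* M) (hjiso : ∀ a, Valued.v (jE a) = Valued.v a) (hjfix : ∀ z, ρ z = z ↔ ∃ c, jE c = z) (hΘj : ∀ c, Θ (jE c) = jE (σ c))
    (hρρ : ∀ x, ρ (ρ x) = x) (hvρ : ∀ x, Valued.v (ρ x) = Valued.v x) (hΘΘ : ∀ x, Θ (Θ x) = x) (hΘρ : ∀ x, Θ (ρ x) = ρ (Θ x))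
    {hM : M} (hΘh : Θ hM = hM) (hh : hM ≠ 0) {j b : ℕ} (hb1 : 1 ≤ b) (hcc : jE ϖ ^ j * (α - ρ α) ≠ 0)
    (hFgap : ∀ z : M, ρ z = z → Θ z = z → Valued.v (jE ϖ) < Valued.v z → Valued.v z ≤ 1 → Valued.v z = 1)
    (hfin : (levelSet ρ Θ α (jE ϖ) hM j b).Finite)
    (hvΘ : ∀ x, Valued.v (Θ x) = Valued.v x) (hα1 : Valued.v α ≤ 1) (hU : Valued.v (α - ρ α) = 1) (hτ : Valued.v (ρ α - Θ α) < 1)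
    {κ₀ ξ₀ : M} (hκ₀ : κ₀ + ρ κ₀ = 1) (hΘκ₀ : Θ κ₀ = κ₀) (hξ : ρ ξ₀ = -ξ₀) (hΘξ : Θ ξ₀ = ξ₀) (hξ0 : ξ₀ ≠ 0)
    {r r₀ : ℤᵐ⁰} (hrR : r * Valued.v ξ₀ * Valued.v (jE ϖ ^ j * (α - ρ α)) < Valued.v (jE ϖ) ^ b)
    (hr₀ : r * Valued.v ξ₀ * Valued.v (jE ϖ ^ j * (α - ρ α)) ≤ r₀ * Valued.v (jE ϖ) ^ b)
    (hdeep : ∀ u : M, ρ u = u → Θ u = u → Valued.v (u - 1) ≤ r₀ → ∃ c : M, ρ c = c ∧ c * Θ c = u)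
    (ε : Prop) {y y' : E} (hσy : σ y = y) (hσy' : σ y' = y')
    (hy : Valued.v (κ₀ + jE y * ξ₀) * Valued.v (jE ϖ ^ j * (α - ρ α)) = Valued.v (jE ϖ) ^ b ∧
      ∃ e : M, ρ e = e ∧ e * Θ e = (κ₀ + jE y * ξ₀) * ρ (κ₀ + jE y * ξ₀) / (hM * ρ hM))
    (hy' : Valued.v (κ₀ + jE y' * ξ₀) * Valued.v (jE ϖ ^ j * (α - ρ α)) = Valued.v (jE ϖ) ^ b ∧
      ∃ e : M, ρ e = e ∧ e * Θ e = (κ₀ + jE y' * ξ₀) * ρ (κ₀ + jE y' * ξ₀) / (hM * ρ hM)) :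
    {Λ : AddSubgroup M | ∃ x₀ : M, (x₀ ≠ 0 ∧ (∀ x, x ∈ Λ ↔ ∃ ζ, IsOrd ρ α (jE ϖ ^ j) ζ ∧ x = x₀ * ζ) ∧
        IsOrd ρ α (jE ϖ ^ j) (dualGen ρ Θ α (jE ϖ ^ j) hM x₀) ∧ ¬ IsOrd ρ α (jE ϖ ^ j) (dualGen ρ Θ α (jE ϖ ^ j) hM x₀ / jE ϖ) ∧
        Valued.v (dualGen ρ Θ α (jE ϖ ^ j) hM x₀) = Valued.v (jE ϖ) ^ b) ∧
        ((∃ e : M, ρ e = e ∧ e * Θ e = hM * (x₀ * Θ x₀) + ρ (hM * (x₀ * Θ x₀))) ↔ ε) ∧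
        Valued.v ((ρ (hM * (x₀ * Θ x₀)) / (hM * (x₀ * Θ x₀) + ρ (hM * (x₀ * Θ x₀))) - κ₀) / ξ₀ - jE y) ≤ r}.ncard =
      {Λ : AddSubgroup M | ∃ x₀ : M, (x₀ ≠ 0 ∧ (∀ x, x ∈ Λ ↔ ∃ ζ, IsOrd ρ α (jE ϖ ^ j) ζ ∧ x = x₀ * ζ) ∧
        IsOrd ρ α (jE ϖ ^ j) (dualGen ρ Θ α (jE ϖ ^ j) hM x₀) ∧ ¬ IsOrd ρ α (jE ϖ ^ j) (dualGen ρ Θ α (jE ϖ ^ j) hM x₀ / jE ϖ) ∧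
        Valued.v (dualGen ρ Θ α (jE ϖ ^ j) hM x₀) = Valued.v (jE ϖ) ^ b) ∧
        ((∃ e : M, ρ e = e ∧ e * Θ e = hM * (x₀ * Θ x₀) + ρ (hM * (x₀ * Θ x₀))) ↔ ε) ∧
        Valued.v ((ρ (hM * (x₀ * Θ x₀)) / (hM * (x₀ * Θ x₀) + ρ (hM * (x₀ * Θ x₀))) - κ₀) / ξ₀ - jE y') ≤ r}.ncard := by
  obtain ⟨-, -, hϖ, -⟩ := id hD
  -- `jE ϖ`: a `ρ`-fixed non-zero element of valuation `< 1`
  have hρϖ : ρ (jE ϖ) = jE ϖ := (hjfix _).2 ⟨ϖ, rfl⟩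
  have hϖlt : Valued.v (jE ϖ) < 1 := by rw [hjiso, hϖ, ← exp_zero, exp_lt_exp]; norm_num
  have hvϖ0 : Valued.v (jE ϖ) ≠ 0 := by rw [hjiso, hϖ]; exact exp_ne_zero
  have hϖ0 : jE ϖ ≠ 0 := (Valuation.ne_zero_iff _).1 hvϖ0
  have hρj : ∀ c' : E, ρ (jE c') = jE c' := fun c' => (hjfix _).2 ⟨c', rfl⟩
  have hccpos : (0 : ℤᵐ⁰) < Valued.v (jE ϖ ^ j * (α - ρ α)) := zero_lt_iff.2 ((Valuation.ne_zero_iff _).2 hcc)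
  -- the two sphere points
  set κ₁ : M := κ₀ + jE y * ξ₀ with hκ₁def
  set κ₂ : M := κ₀ + jE y' * ξ₀ with hκ₂def
  obtain ⟨hR₁, -⟩ := hy
  obtain ⟨hR₂, -⟩ := hy'
  have hκ₁tr : κ₁ + ρ κ₁ = 1 := by rw [hκ₁def, map_add, map_mul, hρj, hξ, ← hκ₀]; ring
  have hκ₂tr : κ₂ + ρ κ₂ = 1 := by rw [hκ₂def, map_add, map_mul, hρj, hξ, ← hκ₀]; ring
  have hΘκ₁ : Θ κ₁ = κ₁ := by rw [hκ₁def, map_add, map_mul, hΘj, hσy, hΘκ₀, hΘξ]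
  have hΘκ₂ : Θ κ₂ = κ₂ := by rw [hκ₂def, map_add, map_mul, hΘj, hσy', hΘκ₀, hΘξ]
  have hκ₂v : Valued.v κ₂ = Valued.v κ₁ := mul_right_cancel₀ hccpos.ne' (by rw [hR₂, hR₁])
  have hvκ₁ : Valued.v κ₁ ≠ 0 := fun h0 => by rw [h0, zero_mul] at hR₁; exact pow_ne_zero _ hvϖ0 hR₁.symm
  have hκ₁0 : κ₁ ≠ 0 := (Valuation.ne_zero_iff _).1 hvκ₁
  have hpos₁ : (0 : ℤᵐ⁰) < Valued.v κ₁ := zero_lt_iff.2 hvκ₁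
  -- LANE A: the flip exists UNCONDITIONALLY — on type U every Θ-fixed unit is a Θ-norm (★ p864540), so no class bookkeeping (`hQ` is not needed)
  have hjϖ : Valued.v (jE ϖ) = exp (-1 : ℤ) := by rw [hjiso, hϖ]
  obtain ⟨hΘN, hN1, -⟩ := transportMul_letters hρρ hvρ hΘρ hΘκ₁ hΘκ₂ hκ₁0 hκ₂v
  obtain ⟨εf, -, hεf⟩ := forall_theta_fixed_unit_isNorm_of_typeU hvρ hΘΘ hvΘ hα1 hU hτ hjϖ _ hΘN hN1
  have _hh' : hM ≠ 0 := hh   -- (kept for socket-shape parity with ★ p864098's (hF); the type-U flip needs no class letter)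
  -- the precision letters at tolerance `r·|ξ₀|`
  have hr : r * Valued.v ξ₀ < Valued.v κ₁ := lt_of_mul_lt_mul_right (by rw [hR₁]; exact hrR) hccpos.le
  have hrr₀ : r * Valued.v ξ₀ ≤ r₀ * Valued.v κ₁ := le_of_mul_le_mul_right (by rw [mul_assoc r₀, hR₁]; exact hr₀) hccpos
  have hΔle : Valued.v (κ₂ - κ₁) ≤ Valued.v κ₁ := (Valuation.map_sub _ _ _).trans (max_le hκ₂v.le le_rfl)
  have hrτ : Valued.v (κ₂ - κ₁) * (r * Valued.v ξ₀) ≤ r₀ * Valued.v κ₁ ^ 2 :=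
    calc Valued.v (κ₂ - κ₁) * (r * Valued.v ξ₀) ≤ Valued.v κ₁ * (r₀ * Valued.v κ₁) := mul_le_mul' hΔle hrr₀
      _ = r₀ * Valued.v κ₁ ^ 2 := by rw [pow_two, mul_left_comm]
  have hμ : Valued.v (0 : M) ≤ (Valued.v (jE ϖ) ^ b) ^ 2 := by rw [Valuation.map_zero]; exact zero_le
  -- ★ p863524 at `μ = 0`, read through §1
  rw [socketFibre_eq_sphereFibre (ρ := ρ) (Θ := Θ) (α := α) jE ϖ hM j b hξ0 r ε y,
    socketFibre_eq_sphereFibre (ρ := ρ) (Θ := Θ) (α := α) jE ϖ hM j b hξ0 r ε y']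
  exact ncard_fibre_eq_ncard_fibre_of_sphere (α := α) (μ := (0 : M)) hρρ hvρ hΘΘ hΘρ hΘh hρϖ hϖ0 hϖlt hb1 hcc hμ hFgap hdeep hκ₁tr hκ₂tr hΘκ₁ hΘκ₂
    hR₁ hκ₂v hr hrτ hεf ε hfin


/-! ## §2 HEAD — (hF) in socket shape, type U -/

/-- **HEAD — LANE A (hF) «THE FIBRES OVER ANY TWO LITERAL DIGITS ARE EQUINUMEROUS», SOCKET SHAPE** (= ★ `fibre_ncard_eq_of_lit_of_gen` with the class letters replaced by the
type-U letters; conclusion BYTE FOR BYTE ★'s, i.e. the (hF) hypothesis of ★ p864098 `cellDiff_eq_zero_of_fibration_reads₄`). [cite: Kottwitz1986BaseChangeUnits, §1 pp. 240–241] [cite: Flicker1998UnitaryFL, Prop. 7 p. 84] [cite: Serre1979, Ch. V §2 Prop. 3] -/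
theorem fibre_ncard_eq_of_lit_of_gen_typeU [CompleteSpace M] [Finite 𝓀[M]] {σ : E →+* E} {ϖ : E} {d tE : ℕ} (hD : IsRamifiedQuadraticDatum σ ϖ d tE)
    (jE : E →+* M) (hjiso : ∀ a, Valued.v (jE a) = Valued.v a) (hjfix : ∀ z, ρ z = z ↔ ∃ c, jE c = z) (hΘj : ∀ c, Θ (jE c) = jE (σ c))
    (hρρ : ∀ x, ρ (ρ x) = x) (hvρ : ∀ x, Valued.v (ρ x) = Valued.v x) (hΘΘ : ∀ x, Θ (Θ x) = x) (hΘρ : ∀ x, Θ (ρ x) = ρ (Θ x))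
    {hM : M} (hΘh : Θ hM = hM) (hh : hM ≠ 0) {j b : ℕ} (hb1 : 1 ≤ b) (hcc : jE ϖ ^ j * (α - ρ α) ≠ 0)
    (hFgap : ∀ z : M, ρ z = z → Θ z = z → Valued.v (jE ϖ) < Valued.v z → Valued.v z ≤ 1 → Valued.v z = 1)
    (hfin : (levelSet ρ Θ α (jE ϖ) hM j b).Finite)
    (hvΘ : ∀ x, Valued.v (Θ x) = Valued.v x) (hα1 : Valued.v α ≤ 1) (hU : Valued.v (α - ρ α) = 1) (hτ : Valued.v (ρ α - Θ α) < 1)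
    {κ₀ ξ₀ : M} (hκ₀ : κ₀ + ρ κ₀ = 1) (hΘκ₀ : Θ κ₀ = κ₀) (hξ : ρ ξ₀ = -ξ₀) (hΘξ : Θ ξ₀ = ξ₀) (hξ0 : ξ₀ ≠ 0)
    {r r₀ : ℤᵐ⁰} (hrR : r * Valued.v ξ₀ * Valued.v (jE ϖ ^ j * (α - ρ α)) < Valued.v (jE ϖ) ^ b)
    (hr₀ : r * Valued.v ξ₀ * Valued.v (jE ϖ ^ j * (α - ρ α)) ≤ r₀ * Valued.v (jE ϖ) ^ b)
    (hdeep : ∀ u : M, ρ u = u → Θ u = u → Valued.v (u - 1) ≤ r₀ → ∃ c : M, ρ c = c ∧ c * Θ c = u)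
    (ε : Prop) (Rd : Finset E) (hRdσ : ∀ V ∈ Rd, σ V = V) (LIT : E → Prop) [DecidablePred LIT]
    (hLIT : ∀ V ∈ Rd, LIT V → Valued.v (κ₀ + jE V * ξ₀) * Valued.v (jE ϖ ^ j * (α - ρ α)) = Valued.v (jE ϖ) ^ b ∧
      ∃ e : M, ρ e = e ∧ e * Θ e = (κ₀ + jE V * ξ₀) * ρ (κ₀ + jE V * ξ₀) / (hM * ρ hM)) :
    ∀ y ∈ Rd.filter LIT, ∀ y' ∈ Rd.filter LIT,
      {Λ : AddSubgroup M | ∃ x₀ : M, (x₀ ≠ 0 ∧ (∀ x, x ∈ Λ ↔ ∃ ζ, IsOrd ρ α (jE ϖ ^ j) ζ ∧ x = x₀ * ζ) ∧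
        IsOrd ρ α (jE ϖ ^ j) (dualGen ρ Θ α (jE ϖ ^ j) hM x₀) ∧ ¬ IsOrd ρ α (jE ϖ ^ j) (dualGen ρ Θ α (jE ϖ ^ j) hM x₀ / jE ϖ) ∧
        Valued.v (dualGen ρ Θ α (jE ϖ ^ j) hM x₀) = Valued.v (jE ϖ) ^ b) ∧
        ((∃ e : M, ρ e = e ∧ e * Θ e = hM * (x₀ * Θ x₀) + ρ (hM * (x₀ * Θ x₀))) ↔ ε) ∧
        Valued.v ((ρ (hM * (x₀ * Θ x₀)) / (hM * (x₀ * Θ x₀) + ρ (hM * (x₀ * Θ x₀))) - κ₀) / ξ₀ - jE y) ≤ r}.ncard =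
      {Λ : AddSubgroup M | ∃ x₀ : M, (x₀ ≠ 0 ∧ (∀ x, x ∈ Λ ↔ ∃ ζ, IsOrd ρ α (jE ϖ ^ j) ζ ∧ x = x₀ * ζ) ∧
        IsOrd ρ α (jE ϖ ^ j) (dualGen ρ Θ α (jE ϖ ^ j) hM x₀) ∧ ¬ IsOrd ρ α (jE ϖ ^ j) (dualGen ρ Θ α (jE ϖ ^ j) hM x₀ / jE ϖ) ∧
        Valued.v (dualGen ρ Θ α (jE ϖ ^ j) hM x₀) = Valued.v (jE ϖ) ^ b) ∧
        ((∃ e : M, ρ e = e ∧ e * Θ e = hM * (x₀ * Θ x₀) + ρ (hM * (x₀ * Θ x₀))) ↔ ε) ∧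
        Valued.v ((ρ (hM * (x₀ * Θ x₀)) / (hM * (x₀ * Θ x₀) + ρ (hM * (x₀ * Θ x₀))) - κ₀) / ξ₀ - jE y') ≤ r}.ncard := by
  intro y hy y' hy'
  obtain ⟨hyR, hyL⟩ := mem_filter.1 hy
  obtain ⟨hyR', hyL'⟩ := mem_filter.1 hy'
  exact ncard_socketFibre_eq_of_lit_typeU (α := α) hD jE hjiso hjfix hΘj hρρ hvρ hΘΘ hΘρ hΘh hh hb1 hcc hFgap hfin hvΘ hα1 hU hτ hκ₀ hΘκ₀ hξ hΘξ hξ0 hrR hr₀ hdeep ε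
    (hRdσ y hyR) (hRdσ y' hyR') (hLIT y hyR hyL) (hLIT y' hyR' hyL')

end Summit.HodgeConjecture.HodgeConjecture.Cruxes.H413.F0P3cDyRamRowCellSocketFibreTypeU

end
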